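import Summits.AtomisticToContinuum.Crystallization.Theorems.FrustratedLawDichotomyStrainedPatchSVCharge
import Mathlib.Analysis.Calculus.MeanValue

/-!
# Strained patch — PRICED CHARGES: the centrosymmetric PAIRING identity, state-dependent remainder prices, and the priced DESCENT to the tube floor
# (decomp-a2c lens-5 «finite/base range + asymptotic regime + bridge», generation 71; crux `AperiodicFrustratedLawGap`, stmt-AtomisticToContinuum-27623)

T-side record: `[CORE-FAR] CoreOffTubeFloor (63/10) (63/10) (24/5) (1/100) 0 ⟸ TubeFloor 𝓘 τ ∧ FamilyCover 𝓘 (24/5) (1/100) (1/8) τ`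
(`…HostCells.coreOff_of_tubeFloor_of_cover_eighth`, generic in the DIAL `(𝓘, τ)`).  New module on top of the landed `…StrainedPatchSVCharge` (p851554);
zero edits to landed declarations; no `sorry`; standard axioms.

WHY (critic row 1188; census SLACK-35, OUTER-30 §4–§7).  The (SV) seam of g70, `tubeFloor_of_svCharge_of_slackCert : SVCharge 𝓘 τ κ X → SlackCert 𝓘 τ κ σ₁ … →
TubeFloor 𝓘 τ`, splits the tube floor into a first-order certificate at force slack `(1+κ)σ₁` (census L-format break-even `s⋆ = 1 + κ₀`: HE52 1.98 / 2.79,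
HZ00 1.57 / 2.23 at `τ = 1/80 / 1/100`) and a CONSTANT bound `κσ₁` on the true-minus-linearised force of every reach row over ALL admissible tube states — a
sup-law nobody can price today (structure-free over the tube: κ ≈ 40–60; adversary ≥ 0.25–0.45).  This module moves the state-dependence to where it can be
computed:

* §1 THE PAIRING IDENTITY [PROVED, pure algebra, any real vector spaces]: for an ODD pair force `f`, a neighbour shell `q` closed under an involution `σ` with
  `q (σ i) = −q i` (every same-sublattice shell of a Bravais or hcp host; the whole shell at an fcc site) and ANY displacement differences `D`,
  `2 • Σ_i f (q i + D i) = Σ_i (f (q i + G i + C i) − f (q i + G i − C i))`, `G = ½(D − D∘σ)` (discrete GRADIENT), `C = ½(D + D∘σ)` (discrete CURVATURE):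
  the force of a centrosymmetric shell is an exact CENTRAL DIFFERENCE IN THE CURVATURE DIRECTION.  Corollaries: odd (e.g. affine) displacements exert NO force
  (`sum_eq_zero_of_odd_disp`, `sum_eq_zero_of_linear` — census REG-30's `c2_aff = 0` to all orders, not just second); an even linearisation sees only
  curvature (`sum_lin_eq_sum_lin_curv`); the Taylor REMAINDER is linear in `C` with a first-order-small coefficient: the per-pair MEAN-VALUE PRICE
  `‖f (q+G+C) − f (q+G−C) − f′ q (2•C)‖ ≤ K · 2‖C‖` whenever `‖f′ x − f′ q‖ ≤ K` on the ball `B(q, m) ∋ q+G±C` [PROVED from Mathlib's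
  `Convex.norm_image_sub_le_of_norm_hasFDerivWithin_le'`] — versus the termwise price `½K₂(‖G+C‖² + ‖G−C‖²)`; ratio `2‖C‖/max‖G±C‖ ∈ (0, 1+√2]`.
* §2 PRICES AS TYPED OBJECTS: a ROW PRICE `Φ : RowPrice` (a functional of the charted state and the row); ★ `PricedCharge 𝓘 τ Φ X` — the remainder of every
  reach row is `≤ Φ(state, a) + X(z₀)(e a)` [for `Φ = termPrice` / `pairPrice` of §3: KNOWN-MATH · ATTACKABLE-L (multivariate Taylor / §1 + chart bookkeeping);
  for `Φ = constPrice (κσ₁)` it IS `SVCharge` (`pricedCharge_const_iff`, `Iff.rfl`)]; ★ `PricedCert 𝓘 τ σ Φ H F X` — the score claim on the Φ-INFLATED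
  (state-dependent, non-convex) linear force polytope `InPricedPolytope`, with the direct seam `tubeFloor_of_pricedCharge_of_pricedCert` (through the tree's
  `forceCapOne`); `PricedCharge.inf` (the min of two prices is a price), monotonicity, family antitonicity, `pricedCert_const_iff` (= `SlackCert`).
* §2b THE PRICED DESCENT [the lens: FINITE RANGE of instrumentable steps + the tree's chain lemma as the BRIDGE]: `PriceTop 𝓘 τ Φ ρ₀` (the price is `≤ ρ₀` on
  the whole tube — arithmetic) and `PriceStep 𝓘 τ σ Φ H F X κ ρ` (the price is `≤ ρ` on the tube ∩ the `κ`-inflated polytope — ONE structured sup computation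
  per host cell, census OUTER-30 §4 engine WITH the tube and WITH the structured price) feed g57's `ForceTaylorBound` / `ForceTaylorBoundIn`, hence
  ★★ `tubeFloor_of_pricedCharge_of_descent : PricedCharge 𝓘 τ Φ X → PriceTop 𝓘 τ Φ (k 0 · σ₁) → (∀ i < n, PriceStep 𝓘 τ σ₁ Φ hessBlk0 force0 X (k i) (k (i+1) · σ₁))
  → SlackCert 𝓘 τ (k n) σ₁ hessBlk0 force0 X → TubeFloor 𝓘 τ` — a finite descending table `k 0 > k 1 > … > k n ≤ s⋆ − 1` closes the T-side; the census
  decides it (ASK-71: is `PriceTop < (max linear row norm at tube amplitude)/σ₁ − 1 ≈ 33–35`, so that the first step bites; then the table).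
* §3 CONCRETE PRICES (definitions only): `termPrice K r` (= the tree's `texEnergy (isoForm (K/2)) r`) and `pairPrice K r` (§1's curvature price on host-
  centrosymmetric partner pairs inside the charted ball, termwise on unpaired bonds — the hcp other-sublattice half-shell, census `c2_aff = 51–68`).
* §4 THE DIAL AND THE PER-CELL TOLERANCE (critic row 1188 exits (X1)/(X2)): (X1) is definitional — every theorem here is generic in `(𝓘, τ)` and
  `coreOff_dial` reads [CORE-FAR] from `TubeFloor FamP τ ∧ FamilyCover FamP (24/5) (1/100) (1/8) τ` at ANY `τ`; (X2) FEASIBILITY = `FamilyCoverSigma 𝓙 τ ρ ε η₂`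
  (a cover by an INDEXED family of (chart family, tolerance) pairs — one tolerance per cell class) with the PROVED junction
  `coreOff_of_tubeFloors_of_coverSigma_eighth : (∀ j, TubeFloor (𝓙 j) (τ j)) → FamilyCoverSigma 𝓙 τ ρ ε (1/8) → CoreOffTubeFloor (63/10) (63/10) ρ ε 0`
  (same conclusion literal, no landed consumer touched; insurance only, not a landing request unless (X1) fails on some host).
-/

namespace Summit.AtomisticToContinuum.Crystallization.Theorems.FrustratedLawDichotomyStrainedPatchChargePrice

open scoped BigOperators Classical RealInnerProductSpace
open Summit.AtomisticToContinuum.Crystallization.Theorems.FrustratedLawDichotomyMotifLemmas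
open Summit.AtomisticToContinuum.Crystallization.Theorems.FrustratedLawDichotomyAveragingCut
open Summit.AtomisticToContinuum.Crystallization.Theorems.FrustratedLawDichotomyStrainedPatchHomSplit
open Summit.AtomisticToContinuum.Crystallization.Theorems.FrustratedLawDichotomyStrainedPatchCleanCollar
open Summit.AtomisticToContinuum.Crystallization.Theorems.FrustratedLawDichotomyStrainedPatchPhaseCut
open Summit.AtomisticToContinuum.Crystallization.Theorems.FrustratedLawDichotomyStrainedPatchCoreTube
open Summit.AtomisticToContinuum.Crystallization.Theorems.FrustratedLawDichotomyStrainedPatchStrainBands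
open Summit.AtomisticToContinuum.Crystallization.Theorems.FrustratedLawDichotomyStrainedPatchHomIsometry
open Summit.AtomisticToContinuum.Crystallization.Theorems.FrustratedLawDichotomyStrainedPatchHomTubeIso
open Summit.AtomisticToContinuum.Crystallization.Theorems.FrustratedLawDichotomyStrainedPatchEnvelopeLaw
open Summit.AtomisticToContinuum.Crystallization.Theorems.FrustratedLawDichotomyStrainedPatchEnvelopeTaylor
open Summit.AtomisticToContinuum.Crystallization.Theorems.FrustratedLawDichotomyStrainedPatchChartFamilies
open Summit.AtomisticToContinuum.Crystallization.Theorems.FrustratedLawDichotomyStrainedPatchChartFamiliesPinned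
open Summit.AtomisticToContinuum.Crystallization.Theorems.FrustratedLawDichotomyStrainedPatchQuantSlaving
open Summit.AtomisticToContinuum.Crystallization.Theorems.FrustratedLawDichotomyStrainedPatchHostCells
open Summit.AtomisticToContinuum.Crystallization.Theorems.FrustratedLawDichotomyStrainedPatchForceCap
open Summit.AtomisticToContinuum.Crystallization.Theorems.FrustratedLawDichotomyStrainedPatchRobustRows
open Summit.AtomisticToContinuum.Crystallization.Theorems.FrustratedLawDichotomyStrainedPatchStretchRows
open Summit.AtomisticToContinuum.Crystallization.Theorems.FrustratedLawDichotomyCollarCensus (Collar)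
open Summit.AtomisticToContinuum.Crystallization.Theorems.FrustratedLawDichotomyExemptAbsorptionRecord (NonEquilibriumCore)
open Summit.AtomisticToContinuum.Crystallization.Theorems.FrustratedLawDichotomyStrainedPatchTextureFloor
open Summit.AtomisticToContinuum.Crystallization.Theorems.FrustratedLawDichotomyStrainedPatchSVCharge

/-! ## §1. The centrosymmetric PAIRING identity (abstract: odd map, shell closed under an involution) -/

section Pairing

variable {ι : Type*} [Fintype ι] {V W : Type*} [AddCommGroup V] [AddCommGroup W] [Module ℝ W]

omit [Module ℝ W] in
/-- Reindexing a finite sum along an involution. [formal bookkeeping] -/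
theorem sum_comp_involutive {σ : ι → ι} (hσ : Function.Involutive σ) (g : ι → W) : ∑ i, g (σ i) = ∑ i, g i := by
  simpa using Equiv.sum_comp (hσ.toPerm σ) g

/-- ★ **PAIRING, difference form**: for `f` odd and a shell `q` with `q (σ i) = −q i`, `2 • Σ f (q i + D i) = Σ (f (q i + D i) − f (q i − D (σ i)))`. [new, elementary] -/
theorem two_smul_sum_eq_sum_sub {f : V → W} (hf : ∀ x, f (-x) = -f x) {σ : ι → ι} (hσ : Function.Involutive σ) {q : ι → V}
    (hq : ∀ i, q (σ i) = -q i) (D : ι → V) :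
    (2 : ℝ) • ∑ i, f (q i + D i) = ∑ i, (f (q i + D i) - f (q i - D (σ i))) := by
  have h1 : ∑ i, f (q i + D i) = ∑ i, f (q (σ i) + D (σ i)) := (sum_comp_involutive hσ (fun i => f (q i + D i))).symm
  have h2 : ∀ i, f (q (σ i) + D (σ i)) = -f (q i - D (σ i)) := fun i => by
    rw [hq, show -q i + D (σ i) = -(q i - D (σ i)) by abel, hf]
  have h3 : ∑ i, f (q i + D i) = -∑ i, f (q i - D (σ i)) := by
    rw [h1, ← Finset.sum_neg_distrib]; exact Finset.sum_congr rfl fun i _ => h2 i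
  rw [Finset.sum_sub_distrib, two_smul, sub_eq_add_neg, ← h3]

variable [Module ℝ V]

/-- Half of `(a − b) + (a + b)`. [formal bookkeeping] -/
theorem half_smul_sub_add_half_smul_add (a b : V) : (1 / 2 : ℝ) • (a - b) + (1 / 2 : ℝ) • (a + b) = a := by
  rw [← smul_add, show a - b + (a + b) = (2 : ℝ) • a by rw [two_smul]; abel, smul_smul]; norm_num

/-- Half of `(a − b) − (a + b)`. [formal bookkeeping] -/
theorem half_smul_sub_sub_half_smul_add (a b : V) : (1 / 2 : ℝ) • (a - b) - (1 / 2 : ℝ) • (a + b) = -b := by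
  rw [← smul_sub, show a - b - (a + b) = (2 : ℝ) • (-b) by rw [two_smul]; abel, smul_smul]; norm_num

/-- ★★ **PAIRING, gradient / curvature form**: with `G i = ½(D i − D (σ i))` and `C i = ½(D i + D (σ i))`,
`2 • Σ f (q i + D i) = Σ (f (q i + G i + C i) − f (q i + G i − C i))` — the shell force is a CENTRAL DIFFERENCE IN THE CURVATURE DIRECTION. [new, elementary] -/
theorem two_smul_sum_eq_sum_centralDiff {f : V → W} (hf : ∀ x, f (-x) = -f x) {σ : ι → ι} (hσ : Function.Involutive σ) {q : ι → V}
    (hq : ∀ i, q (σ i) = -q i) (D : ι → V) :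
    (2 : ℝ) • ∑ i, f (q i + D i) =
      ∑ i, (f (q i + (1 / 2 : ℝ) • (D i - D (σ i)) + (1 / 2 : ℝ) • (D i + D (σ i))) -
        f (q i + (1 / 2 : ℝ) • (D i - D (σ i)) - (1 / 2 : ℝ) • (D i + D (σ i)))) := by
  rw [two_smul_sum_eq_sum_sub hf hσ hq D]
  refine Finset.sum_congr rfl fun i _ => ?_
  rw [add_assoc, half_smul_sub_add_half_smul_add, add_sub_assoc, half_smul_sub_sub_half_smul_add, ← sub_eq_add_neg]

omit [Module ℝ V] in
/-- ★ **ODD DISPLACEMENTS EXERT NO FORCE**: if `D (σ i) = −D i` for all `i` (zero curvature), `Σ f (q i + D i) = 0`. [new, elementary] -/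
theorem sum_eq_zero_of_odd_disp {f : V → W} (hf : ∀ x, f (-x) = -f x) {σ : ι → ι} (hσ : Function.Involutive σ) {q : ι → V}
    (hq : ∀ i, q (σ i) = -q i) {D : ι → V} (hD : ∀ i, D (σ i) = -D i) : ∑ i, f (q i + D i) = 0 := by
  have h := two_smul_sum_eq_sum_sub hf hσ hq D
  have h0 : ∑ i, (f (q i + D i) - f (q i - D (σ i))) = 0 := Finset.sum_eq_zero fun i _ => by rw [hD, sub_neg_eq_add, sub_self]
  rw [h0] at h
  exact (smul_eq_zero.1 h).resolve_left two_ne_zero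

omit [Module ℝ V] in
/-- In particular the undeformed centrosymmetric shell is force-free: `Σ f (q i) = 0`. [formal bookkeeping] -/
theorem sum_eq_zero_of_centrosymmetric {f : V → W} (hf : ∀ x, f (-x) = -f x) {σ : ι → ι} (hσ : Function.Involutive σ) {q : ι → V}
    (hq : ∀ i, q (σ i) = -q i) : ∑ i, f (q i) = 0 := by
  simpa using sum_eq_zero_of_odd_disp (D := fun _ => (0 : V)) hf hσ hq (fun _ => by simp)

/-- ★ **AFFINE (LINEAR) DISPLACEMENTS EXERT NO FORCE at a centrosymmetric site** (census REG-30 `c2_aff = 0` at fcc sites, to ALL orders). [new, elementary] -/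
theorem sum_eq_zero_of_linear {f : V → W} (hf : ∀ x, f (-x) = -f x) {σ : ι → ι} (hσ : Function.Involutive σ) {q : ι → V}
    (hq : ∀ i, q (σ i) = -q i) (A : V →ₗ[ℝ] V) : ∑ i, f (q i + A (q i)) = 0 :=
  sum_eq_zero_of_odd_disp (D := fun i => A (q i)) hf hσ hq fun i => by rw [hq, map_neg]

/-- ★ **AN EVEN LINEARISATION SEES ONLY CURVATURE**: for `L (−x) = L x` (e.g. the pair Hessian), `Σ L (q i) (D i) = Σ L (q i) (½(D i + D (σ i)))`. [new, elementary] -/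
theorem sum_lin_eq_sum_lin_curv {L : V → V →ₗ[ℝ] W} (hL : ∀ x, L (-x) = L x) {σ : ι → ι} (hσ : Function.Involutive σ) {q : ι → V}
    (hq : ∀ i, q (σ i) = -q i) (D : ι → V) : ∑ i, L (q i) (D i) = ∑ i, L (q i) ((1 / 2 : ℝ) • (D i + D (σ i))) := by
  have h1 : ∑ i, L (q i) (D i) = ∑ i, L (q i) (D (σ i)) := by
    rw [← sum_comp_involutive hσ (fun i => L (q i) (D i))]
    exact Finset.sum_congr rfl fun i _ => by rw [hq, hL]
  have h2 : ∑ i, L (q i) ((1 / 2 : ℝ) • (D i + D (σ i))) = (1 / 2 : ℝ) • (∑ i, L (q i) (D i) + ∑ i, L (q i) (D (σ i))) := by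
    rw [← Finset.sum_add_distrib, Finset.smul_sum]
    exact Finset.sum_congr rfl fun i _ => by rw [map_smul, map_add]
  rw [h2, ← h1, ← two_smul ℝ (∑ i, L (q i) (D i)), smul_smul]
  norm_num

/-- ★★ **THE REMAINDER IS CURVATURE-LINEAR**: with `Σ f (q i) = 0` automatic and an even linearisation `L`,
`2 • Σ (f (q i + D i) − f (q i) − L (q i) (D i)) = Σ (f (q i + G i + C i) − f (q i + G i − C i) − L (q i) (2 • C i))`. [new, elementary] -/
theorem two_smul_remainder_eq {f : V → W} (hf : ∀ x, f (-x) = -f x) {L : V → V →ₗ[ℝ] W} (hL : ∀ x, L (-x) = L x) {σ : ι → ι}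
    (hσ : Function.Involutive σ) {q : ι → V} (hq : ∀ i, q (σ i) = -q i) (D : ι → V) :
    (2 : ℝ) • ∑ i, (f (q i + D i) - f (q i) - L (q i) (D i)) =
      ∑ i, (f (q i + (1 / 2 : ℝ) • (D i - D (σ i)) + (1 / 2 : ℝ) • (D i + D (σ i))) -
        f (q i + (1 / 2 : ℝ) • (D i - D (σ i)) - (1 / 2 : ℝ) • (D i + D (σ i))) - L (q i) ((2 : ℝ) • ((1 / 2 : ℝ) • (D i + D (σ i))))) := by
  have hf0 : ∑ i, f (q i) = 0 := sum_eq_zero_of_centrosymmetric hf hσ hq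
  have hL2 : (2 : ℝ) • ∑ i, L (q i) (D i) = ∑ i, L (q i) ((2 : ℝ) • ((1 / 2 : ℝ) • (D i + D (σ i)))) := by
    rw [sum_lin_eq_sum_lin_curv hL hσ hq D, Finset.smul_sum]
    exact Finset.sum_congr rfl fun i _ => by simp only [map_smul]
  rw [Finset.sum_sub_distrib, Finset.sum_sub_distrib, hf0, sub_zero, smul_sub, two_smul_sum_eq_sum_centralDiff hf hσ hq D, hL2,
    ← Finset.sum_sub_distrib]

end Pairing

section Price

variable {V W : Type*} [NormedAddCommGroup V] [NormedSpace ℝ V] [NormedAddCommGroup W] [NormedSpace ℝ W]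

/-- ★★ **THE PER-PAIR MEAN-VALUE PRICE** [KNOWN-MATH, proved]: if `f` has derivative `f′ x` at every point of the closed ball `B(q, m)`, `‖f′ x − f′ q‖ ≤ K` there,
and `q + G ± C ∈ B(q, m)`, then `‖f (q+G+C) − f (q+G−C) − f′ q (2 • C)‖ ≤ K · (2‖C‖)`.  With `f′` `K₂`-Lipschitz on the ball, `K = K₂ m`: the pair's
remainder costs `2 K₂ ‖C‖ m` against the termwise `½ K₂ (‖G+C‖² + ‖G−C‖²)`. -/
theorem norm_centralDiff_sub_le {f : V → W} {f' : V → V →L[ℝ] W} {q G C : V} {K m : ℝ}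
    (hf : ∀ x ∈ Metric.closedBall q m, HasFDerivAt f (f' x) x) (hK : ∀ x ∈ Metric.closedBall q m, ‖f' x - f' q‖ ≤ K)
    (hGp : ‖G + C‖ ≤ m) (hGm : ‖G - C‖ ≤ m) : ‖f (q + G + C) - f (q + G - C) - f' q ((2 : ℝ) • C)‖ ≤ K * (2 * ‖C‖) := by
  have hx : q + G - C ∈ Metric.closedBall q m := by
    rw [Metric.mem_closedBall, dist_eq_norm, show q + G - C - q = G - C by abel]; exact hGm
  have hy : q + G + C ∈ Metric.closedBall q m := by
    rw [Metric.mem_closedBall, dist_eq_norm, show q + G + C - q = G + C by abel]; exact hGp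
  have h := Convex.norm_image_sub_le_of_norm_hasFDerivWithin_le' (f := f) (f' := f') (φ := f' q) (s := Metric.closedBall q m)
    (fun x hx => (hf x hx).hasFDerivWithinAt) hK (convex_closedBall q m) hx hy
  have hd : q + G + C - (q + G - C) = (2 : ℝ) • C := by rw [two_smul]; abel
  rw [hd, norm_smul, Real.norm_eq_abs, abs_of_pos (by norm_num : (0 : ℝ) < 2)] at h
  exact h

end Price

/-! ## §2. Row prices, the priced charge, the priced certificate, and the seams -/

/-- A ROW PRICE: a functional of the charted cluster `(z, c)`, the instance `(z₀, c₀)`, the chart `e` and the row `a`. -/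
abbrev RowPrice := (M : ℕ) → (Fin M → E3) → Fin M → (M₀ : ℕ) → (Fin M₀ → E3) → Fin M₀ → (Fin M → Fin M₀) → Fin M → ℝ

/-- The constant price `≡ ρ`. -/
def constPrice (ρ : ℝ) : RowPrice := fun _ _ _ _ _ _ _ _ => ρ

/-- The pointwise minimum of two prices. -/
def RowPrice.inf (Φ Ψ : RowPrice) : RowPrice := fun M z c M₀ z₀ c₀ e a => min (Φ M z c M₀ z₀ c₀ e a) (Ψ M z c M₀ z₀ c₀ e a)

/-- ★★ **`PricedCharge 𝓘 τ Φ X`** [STATE-DEPENDENT remainder law — for the structured prices of §3 KNOWN-MATH · ATTACKABLE-L; for `constPrice (κσ₁)` = `SVCharge`]: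
on every admissible clean mono-phase `𝓘`-charted cluster (coarse radius `τ`, roughness `t ≤ τ`, fine radius `τ`) the true move-test force at each reach row is
within `Φ(state, a) + X(z₀)(e a)` of its linearisation through `(hessBlk0, force0)`.  Same binders as g57's `ForceTaylorBound`. -/
def PricedCharge (𝓘 : ChartFam) (τ : ℝ) (Φ : RowPrice) (X : SlackTab) : Prop :=
  ∀ (M : ℕ) (z : Fin M → E3) (c : Fin M) (M₀ : ℕ) (z₀ : Fin M₀ → E3) (c₀ : Fin M₀) (e : Fin M → Fin M₀) (t : ℝ),
    Admissible M z c → CleanBall (63 / 10) z c → MonoPhaseBall (63 / 10) z c → 0 ≤ t → t ≤ constLaw τ M₀ z₀ c₀ → ChartBy 𝓘 τ t z c z₀ c₀ e →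
      FineChart τ z c z₀ c₀ e → ∀ a ∈ ball (63 / 10) z c, IsReach z c a →
        ‖siteForce 7 z a - linForce hessBlk0 force0 z c z₀ c₀ e a‖ ≤ Φ M z c M₀ z₀ c₀ e a + X M₀ z₀ c₀ (e a)

/-- At the constant price `κσ₁` the priced charge IS g70's `SVCharge`. [formal bookkeeping] -/
theorem pricedCharge_const_iff (𝓘 : ChartFam) (τ κ : ℝ) (X : SlackTab) : PricedCharge 𝓘 τ (constPrice (κ * sigmaOne)) X ↔ SVCharge 𝓘 τ κ X := Iff.rfl

/-- **`InPricedPolytope σ Φ H F X`** — the chart's deviation field satisfies the Φ-INFLATED linear force rows `‖linForce H F … a‖ ≤ σ + Φ(state, a) + X(z₀)(e a)`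
(a NON-CONVEX set when `Φ` depends on the state). -/
def InPricedPolytope (σ : ℝ) (Φ : RowPrice) (H : HessTab) (F : ForceTab) (X : SlackTab) {M : ℕ} (z : Fin M → E3) (c : Fin M) {M₀ : ℕ}
    (z₀ : Fin M₀ → E3) (c₀ : Fin M₀) (e : Fin M → Fin M₀) : Prop :=
  ∀ a ∈ ball (63 / 10) z c, IsReach z c a → ‖linForce H F z c z₀ c₀ e a‖ ≤ σ + Φ M z c M₀ z₀ c₀ e a + X M₀ z₀ c₀ (e a)

/-- ★ **`PricedCert 𝓘 τ σ Φ H F X`** [the strongest certificate format: the score claim on the Φ-inflated polytope ∩ the tube] — instrumentable directly only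
through a convex relaxation; the census-ready form is the DESCENT of §2b. -/
def PricedCert (𝓘 : ChartFam) (τ σ : ℝ) (Φ : RowPrice) (H : HessTab) (F : ForceTab) (X : SlackTab) : Prop :=
  ∀ (M : ℕ) (z : Fin M → E3) (c : Fin M) (M₀ : ℕ) (z₀ : Fin M₀ → E3) (c₀ : Fin M₀) (e : Fin M → Fin M₀),
    Admissible M z c → CleanBall (63 / 10) z c → MonoPhaseBall (63 / 10) z c → ChartBy 𝓘 τ τ z c z₀ c₀ e →
      InPricedPolytope σ Φ H F X z c z₀ c₀ e → 0 ≤ ballAvg (9 / 5) z (xRec M z) c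

/-- At the constant price `κσ` the priced certificate IS g70's `SlackCert`. [formal bookkeeping] -/
theorem pricedCert_const_iff (𝓘 : ChartFam) (τ κ σ : ℝ) (H : HessTab) (F : ForceTab) (X : SlackTab) :
    PricedCert 𝓘 τ σ (constPrice (κ * σ)) H F X ↔ SlackCert 𝓘 τ κ σ H F X := by
  have key : ∀ {M : ℕ} (z : Fin M → E3) (c : Fin M) {M₀ : ℕ} (z₀ : Fin M₀ → E3) (c₀ : Fin M₀) (e : Fin M → Fin M₀),
      InPricedPolytope σ (constPrice (κ * σ)) H F X z c z₀ c₀ e ↔ InForcePolytope κ σ H F X z c z₀ c₀ e := by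
    intro M z c M₀ z₀ c₀ e
    refine forall₃_congr fun a _ _ => ?_
    rw [constPrice, show σ + κ * σ = (1 + κ) * σ by ring]
  refine forall₄_congr fun M z c M₀ => forall₃_congr fun z₀ c₀ e => forall₄_congr fun _ _ _ _ => ?_
  rw [key]

/-- ★★ **THE DIRECT SEAM**: priced charge ∧ priced certificate at `σ₁` through the record tables ⟹ tube floor (via the tree's `forceCapOne`). [folklore] -/
theorem tubeFloor_of_pricedCharge_of_pricedCert {𝓘 : ChartFam} {τ : ℝ} {Φ : RowPrice} {X : SlackTab} (hτ : 0 ≤ τ) (hS : PricedCharge 𝓘 τ Φ X)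
    (hC : PricedCert 𝓘 τ sigmaOne Φ hessBlk0 force0 X) : TubeFloor 𝓘 τ :=
  fun M z c M₀ z₀ c₀ e hz hcl hm hch => hC M z c M₀ z₀ c₀ e hz hcl hm hch fun a ha hr =>
    norm_lin_le_of_cap_of_rem (forceCapOne M z c hz a hr) (hS M z c M₀ z₀ c₀ e τ hz hcl hm hτ le_rfl hch (fineChart_of_chartBy hch) a ha hr)

/-- (TF) ⟹ `PricedCert` at every price: the certificate is never stronger than the claim it serves. [formal bookkeeping] -/
theorem pricedCert_of_tubeFloor {𝓘 : ChartFam} {τ : ℝ} (σ : ℝ) (Φ : RowPrice) (H : HessTab) (F : ForceTab) (X : SlackTab) (h : TubeFloor 𝓘 τ) :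
    PricedCert 𝓘 τ σ Φ H F X := fun M z c M₀ z₀ c₀ e hz hcl hm hch _ => h M z c M₀ z₀ c₀ e hz hcl hm hch

/-- The priced charge is MONOTONE in the price. [formal bookkeeping] -/
theorem PricedCharge.mono {𝓘 : ChartFam} {τ : ℝ} {Φ Ψ : RowPrice} {X : SlackTab} (hle : ∀ M z c M₀ z₀ c₀ e a, Φ M z c M₀ z₀ c₀ e a ≤ Ψ M z c M₀ z₀ c₀ e a)
    (h : PricedCharge 𝓘 τ Φ X) : PricedCharge 𝓘 τ Ψ X :=
  fun M z c M₀ z₀ c₀ e t hz hcl hm ht htT hch hf a ha hr => (h M z c M₀ z₀ c₀ e t hz hcl hm ht htT hch hf a ha hr).trans (by linarith [hle M z c M₀ z₀ c₀ e a])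

/-- ★ **THE MIN OF TWO PRICES IS A PRICE** (termwise ⊓ pairing, per row). [formal bookkeeping] -/
theorem PricedCharge.inf {𝓘 : ChartFam} {τ : ℝ} {Φ Ψ : RowPrice} {X : SlackTab} (hΦ : PricedCharge 𝓘 τ Φ X) (hΨ : PricedCharge 𝓘 τ Ψ X) :
    PricedCharge 𝓘 τ (Φ.inf Ψ) X := fun M z c M₀ z₀ c₀ e t hz hcl hm ht htT hch hf a ha hr => by
  rw [RowPrice.inf, min_add_add_right (α := ℝ) .. |>.symm]
  exact le_min (hΦ M z c M₀ z₀ c₀ e t hz hcl hm ht htT hch hf a ha hr) (hΨ M z c M₀ z₀ c₀ e t hz hcl hm ht htT hch hf a ha hr)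

/-- The priced charge is ANTITONE in the family. [formal bookkeeping] -/
theorem PricedCharge.anti_family {𝓘 𝓘' : ChartFam} (hle : FamilyLE 𝓘 𝓘') {τ : ℝ} {Φ : RowPrice} {X : SlackTab} (h : PricedCharge 𝓘' τ Φ X) :
    PricedCharge 𝓘 τ Φ X := fun M z c M₀ z₀ c₀ e t hz hcl hm ht htT hch => h M z c M₀ z₀ c₀ e t hz hcl hm ht htT ⟨hle _ _ _ hch.1, hch.2⟩

/-- The priced certificate is ANTITONE in the price. [formal bookkeeping] -/
theorem PricedCert.anti {𝓘 : ChartFam} {τ σ : ℝ} {Φ Ψ : RowPrice} {H : HessTab} {F : ForceTab} {X : SlackTab}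
    (hle : ∀ M z c M₀ z₀ c₀ e a, Φ M z c M₀ z₀ c₀ e a ≤ Ψ M z c M₀ z₀ c₀ e a) (h : PricedCert 𝓘 τ σ Ψ H F X) : PricedCert 𝓘 τ σ Φ H F X :=
  fun M z c M₀ z₀ c₀ e hz hcl hm hch hP => h M z c M₀ z₀ c₀ e hz hcl hm hch fun a ha hr => (hP a ha hr).trans (by linarith [hle M z c M₀ z₀ c₀ e a])

/-! ## §2b. The priced DESCENT: `PriceTop`, `PriceStep`, and the chain to the tube floor through g57's enclosure ladder -/

/-- ★ **`PriceTop 𝓘 τ Φ ρ`** [arithmetic · INSTRUMENTABLE] — the price is `≤ ρ` at every reach row of every charted admissible tube state (the a-priori level). -/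
def PriceTop (𝓘 : ChartFam) (τ : ℝ) (Φ : RowPrice) (ρ : ℝ) : Prop :=
  ∀ (M : ℕ) (z : Fin M → E3) (c : Fin M) (M₀ : ℕ) (z₀ : Fin M₀ → E3) (c₀ : Fin M₀) (e : Fin M → Fin M₀) (t : ℝ),
    Admissible M z c → CleanBall (63 / 10) z c → MonoPhaseBall (63 / 10) z c → 0 ≤ t → t ≤ constLaw τ M₀ z₀ c₀ → ChartBy 𝓘 τ t z c z₀ c₀ e →
      FineChart τ z c z₀ c₀ e → ∀ a ∈ ball (63 / 10) z c, IsReach z c a → Φ M z c M₀ z₀ c₀ e a ≤ ρ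

/-- ★ **`PriceStep 𝓘 τ σ Φ H F X κ ρ`** [INSTRUMENTABLE — one structured sup computation per host cell: `sup {Φ(state, a) : state ∈ tube ∩ P(κ)} ≤ ρ`] — on the
`κ`-inflated polytope the price is `≤ ρ` at every reach row. -/
def PriceStep (𝓘 : ChartFam) (τ σ : ℝ) (Φ : RowPrice) (H : HessTab) (F : ForceTab) (X : SlackTab) (κ ρ : ℝ) : Prop :=
  ∀ (M : ℕ) (z : Fin M → E3) (c : Fin M) (M₀ : ℕ) (z₀ : Fin M₀ → E3) (c₀ : Fin M₀) (e : Fin M → Fin M₀) (t : ℝ),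
    Admissible M z c → CleanBall (63 / 10) z c → MonoPhaseBall (63 / 10) z c → 0 ≤ t → t ≤ constLaw τ M₀ z₀ c₀ → ChartBy 𝓘 τ t z c z₀ c₀ e →
      FineChart τ z c z₀ c₀ e → InForcePolytope κ σ H F X z c z₀ c₀ e → ∀ a ∈ ball (63 / 10) z c, IsReach z c a → Φ M z c M₀ z₀ c₀ e a ≤ ρ

/-- Priced charge ∧ top ⟹ g57's a-priori Taylor bound (TFR ρ). [formal bookkeeping] -/
theorem forceTaylorBound_of_pricedCharge_of_top {𝓘 : ChartFam} {τ ρ : ℝ} {Φ : RowPrice} {X : SlackTab} (hS : PricedCharge 𝓘 τ Φ X)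
    (hT : PriceTop 𝓘 τ Φ ρ) : ForceTaylorBound 𝓘 τ τ (constLaw τ) ρ hessBlk0 force0 X :=
  fun M z c M₀ z₀ c₀ e t hz hcl hm ht htT hch hf a ha hr =>
    (hS M z c M₀ z₀ c₀ e t hz hcl hm ht htT hch hf a ha hr).trans (by linarith [hT M z c M₀ z₀ c₀ e t hz hcl hm ht htT hch hf a ha hr])

/-- Priced charge ∧ step ⟹ g57's structured Taylor bound on the polytope (TFR-in κ ρ). [formal bookkeeping] -/
theorem forceTaylorBoundIn_of_pricedCharge_of_step {𝓘 : ChartFam} {τ σ κ ρ : ℝ} {Φ : RowPrice} {X : SlackTab} (hS : PricedCharge 𝓘 τ Φ X)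
    (hs : PriceStep 𝓘 τ σ Φ hessBlk0 force0 X κ ρ) : ForceTaylorBoundIn 𝓘 τ τ (constLaw τ) κ σ ρ hessBlk0 force0 X :=
  fun M z c M₀ z₀ c₀ e t hz hcl hm ht htT hch hf hP a ha hr =>
    (hS M z c M₀ z₀ c₀ e t hz hcl hm ht htT hch hf a ha hr).trans (by linarith [hs M z c M₀ z₀ c₀ e t hz hcl hm ht htT hch hf hP a ha hr])

/-- ★★★ **THE PRICED DESCENT TO THE TUBE FLOOR** — a priced charge, its a-priori top `k 0 · σ₁`, a FINITE descending table of steps `k i ↦ k (i+1)` on the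
successive polytopes, and the first-order certificate at the last slack `k n` (census `CERT(1 + k n)`) give (TF).  The lens in one theorem: finite range of
instrumentable steps (`PriceStep`), the structured price as the analytic regime (`PricedCharge`), g57's chain lemma as the bridge. [folklore composition] -/
theorem tubeFloor_of_pricedCharge_of_descent {𝓘 : ChartFam} {τ : ℝ} {Φ : RowPrice} {X : SlackTab} (k : ℕ → ℝ) (n : ℕ) (hτ : 0 ≤ τ)
    (hS : PricedCharge 𝓘 τ Φ X) (h0 : PriceTop 𝓘 τ Φ (k 0 * sigmaOne))
    (hs : ∀ i : ℕ, i < n → PriceStep 𝓘 τ sigmaOne Φ hessBlk0 force0 X (k i) (k (i + 1) * sigmaOne))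
    (hC : SlackCert 𝓘 τ (k n) sigmaOne hessBlk0 force0 X) : TubeFloor 𝓘 τ :=
  tubeFloor_of_enclosure_of_slackCert hτ
    (slavingEnclosure_of_chain k n (slavingEnclosure_of_forceCap forceCapOne (forceTaylorBound_of_pricedCharge_of_top hS h0))
      fun i hi => remainderStep_of_forceCap forceCapOne (forceTaylorBoundIn_of_pricedCharge_of_step hS (hs i hi))) hC

/-- One-step member (`n = 1`): top `k₀σ₁`, one step `k₀ ↦ κσ₁`, certificate at slack `1 + κ`. [formal bookkeeping] -/
theorem tubeFloor_of_pricedCharge_of_oneStep {𝓘 : ChartFam} {τ k₀ κ : ℝ} {Φ : RowPrice} {X : SlackTab} (hτ : 0 ≤ τ) (hS : PricedCharge 𝓘 τ Φ X)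
    (h0 : PriceTop 𝓘 τ Φ (k₀ * sigmaOne)) (h1 : PriceStep 𝓘 τ sigmaOne Φ hessBlk0 force0 X k₀ (κ * sigmaOne))
    (hC : SlackCert 𝓘 τ κ sigmaOne hessBlk0 force0 X) : TubeFloor 𝓘 τ :=
  tubeFloor_of_pricedCharge_of_descent (fun i => if i = 0 then k₀ else κ) 1 hτ hS (by simpa using h0)
    (fun i hi => by interval_cases i; simpa using h1) (by simpa using hC)

/-- `PriceTop` is implied by `PriceStep` at any `κ` only on the polytope; conversely a top is a step at every `κ`. [formal bookkeeping] -/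
theorem priceStep_of_priceTop {𝓘 : ChartFam} {τ σ ρ : ℝ} {Φ : RowPrice} {H : HessTab} {F : ForceTab} {X : SlackTab} (κ : ℝ) (h : PriceTop 𝓘 τ Φ ρ) :
    PriceStep 𝓘 τ σ Φ H F X κ ρ := fun M z c M₀ z₀ c₀ e t hz hcl hm ht htT hch hf _ => h M z c M₀ z₀ c₀ e t hz hcl hm ht htT hch hf

/-- `PriceStep` is MONOTONE in the target and ANTITONE in the polytope (`σ ≥ 0`). [formal bookkeeping] -/
theorem PriceStep.mono {𝓘 : ChartFam} {τ σ κ κ' ρ ρ' : ℝ} {Φ : RowPrice} {H : HessTab} {F : ForceTab} {X : SlackTab} (hκ : κ' ≤ κ) (hσ : 0 ≤ σ)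
    (hρ : ρ ≤ ρ') (h : PriceStep 𝓘 τ σ Φ H F X κ ρ) : PriceStep 𝓘 τ σ Φ H F X κ' ρ' :=
  fun M z c M₀ z₀ c₀ e t hz hcl hm ht htT hch hf hP a ha hr => (h M z c M₀ z₀ c₀ e t hz hcl hm ht htT hch hf (inForcePolytope_mono hκ hσ hP) a ha hr).trans hρ

/-! ## §3. Concrete prices (definitions): termwise and pairing -/

/-- **TERMWISE PRICE** `Σ_{b ≠ a charted, host distance < r} ½ K(host distance) ‖Δ_ab‖²` = the tree's texture energy with the ISO form `K/2`.  With `K` a Lipschitz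
bound of `pairHess` on the relevant annuli and `X` the partners beyond `r` / uncharted, `PricedCharge 𝓘 τ (termPrice K r) X` is multivariate Taylor
[KNOWN-MATH · ATTACKABLE-L]; structure-free it tops at κ ≈ 40–60 over the `1/80` tube (census OUTER-30 §4 currency). -/
noncomputable def termPrice (K : ℝ → ℝ) (r : ℝ) : RowPrice := fun _ z c _ z₀ c₀ e a => texEnergy (isoForm fun s => K s / 2) r z c z₀ c₀ e a

/-- The host-centrosymmetric PARTNERS of `b` in row `a`'s charted shell: charted sites whose host bond from `e a` is minus that of `b`. -/
noncomputable def partners {M : ℕ} (z : Fin M → E3) (c : Fin M) {M₀ : ℕ} (z₀ : Fin M₀ → E3) (e : Fin M → Fin M₀) (a b : Fin M) : Finset (Fin M) :=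
  (ball (63 / 10) z c).filter fun b' => z₀ (e b') - z₀ (e a) = -(z₀ (e b) - z₀ (e a))

/-- ★ **PAIRING PRICE** (§1): on each host-centrosymmetric partner pair `(b, b′)` of row `a` the curvature price `K · ‖½(Δ_ab + Δ_ab′)‖ · max ‖Δ_ab‖ ‖Δ_ab′‖`
(summed over ordered pairs = `2K‖C‖m` per pair), termwise `½K‖Δ_ab‖²` on UNPAIRED bonds (the hcp other-sublattice half-shell; rows near the chart rim).
`PricedCharge 𝓘 τ (pairPrice K r) X` is §1 + the mean-value price + chart bookkeeping [KNOWN-MATH · ATTACKABLE-L]. -/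
noncomputable def pairPrice (K : ℝ → ℝ) (r : ℝ) : RowPrice := fun _ z c _ z₀ c₀ e a =>
  ∑ b ∈ (ball (63 / 10) z c).filter (fun b => b ≠ a ∧ dist (z₀ (e b)) (z₀ (e a)) < r),
    ((∑ b' ∈ partners z c z₀ e a b,
        K ‖z₀ (e b) - z₀ (e a)‖ * ‖(1 / 2 : ℝ) • ((dev z c z₀ c₀ e b - dev z c z₀ c₀ e a) + (dev z c z₀ c₀ e b' - dev z c z₀ c₀ e a))‖ *
          max ‖dev z c z₀ c₀ e b - dev z c z₀ c₀ e a‖ ‖dev z c z₀ c₀ e b' - dev z c z₀ c₀ e a‖) +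
      if (partners z c z₀ e a b).Nonempty then 0 else K ‖z₀ (e b) - z₀ (e a)‖ / 2 * ‖dev z c z₀ c₀ e b - dev z c z₀ c₀ e a‖ ^ 2)

/-! ## §4. The DIAL `(𝓘, τ)` and the per-cell tolerance (critic row 1188, exits (X1) / (X2)) -/

/-- ★ (X1) **THE DIAL MEMBER**: [CORE-FAR] from the record family at ANY tolerance `τ` (the junction is the tree's generic `coreOff_of_tubeFloor_of_cover_eighth`). -/
theorem coreOff_dial {τ : ℝ} (hT : TubeFloor FamP τ) (hC : FamilyCover FamP (24 / 5) (1 / 100) (1 / 8) τ) :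
    CoreOffTubeFloor (63 / 10) (63 / 10) (24 / 5) (1 / 100) 0 := coreOff_of_tubeFloor_of_cover_eighth hT hC

/-- ★★ (X1) ∧ DESCENT: [CORE-FAR] at dial `(𝓘, τ)` from a priced descent and a cover at `τ`. [formal bookkeeping] -/
theorem coreOff_of_descent_of_cover {𝓘 : ChartFam} {τ ρ ε : ℝ} {Φ : RowPrice} {X : SlackTab} (k : ℕ → ℝ) (n : ℕ) (hτ : 0 ≤ τ)
    (hS : PricedCharge 𝓘 τ Φ X) (h0 : PriceTop 𝓘 τ Φ (k 0 * sigmaOne))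
    (hs : ∀ i : ℕ, i < n → PriceStep 𝓘 τ sigmaOne Φ hessBlk0 force0 X (k i) (k (i + 1) * sigmaOne))
    (hC : SlackCert 𝓘 τ (k n) sigmaOne hessBlk0 force0 X) (hCov : FamilyCover 𝓘 ρ ε (1 / 8) τ) : CoreOffTubeFloor (63 / 10) (63 / 10) ρ ε 0 :=
  coreOff_of_tubeFloor_of_cover_eighth (tubeFloor_of_pricedCharge_of_descent k n hτ hS h0 hs hC) hCov

/-- RECORD member at `(FamP, 1/80)` with `CoverP`. [formal bookkeeping] -/
theorem coreOff_record_of_descent {Φ : RowPrice} {X : SlackTab} (k : ℕ → ℝ) (n : ℕ) (hS : PricedCharge FamP (1 / 80) Φ X)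
    (h0 : PriceTop FamP (1 / 80) Φ (k 0 * sigmaOne)) (hs : ∀ i : ℕ, i < n → PriceStep FamP (1 / 80) sigmaOne Φ hessBlk0 force0 X (k i) (k (i + 1) * sigmaOne))
    (hC : SlackCert FamP (1 / 80) (k n) sigmaOne hessBlk0 force0 X) (hCov : CoverP) : CoreOffTubeFloor (63 / 10) (63 / 10) (24 / 5) (1 / 100) 0 :=
  coreOff_of_descent_of_cover k n (by norm_num) hS h0 hs hC hCov

/-- ★ (X2) **COVER BY AN INDEXED FAMILY OF (chart family, tolerance) PAIRS** — one tolerance per cell class `j`. -/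
def FamilyCoverSigma {J : Type*} (𝓙 : J → ChartFam) (τ : J → ℝ) (ρ ε η₂ : ℝ) : Prop :=
  ∀ (M : ℕ) (z : Fin M → E3) (c : Fin M), Admissible M z c → CleanBall (63 / 10) z c → MonoPhaseBall (63 / 10) z c → ¬NearHomIsoAt ρ ε z c →
    GoodAtScale η₂ (3 / 2) z c →
      ∃ (j : J) (R : E3 ≃ₗᵢ[ℝ] E3) (M₀ : ℕ) (z₀ : Fin M₀ → E3) (c₀ : Fin M₀) (e : Fin M → Fin M₀), ChartBy (𝓙 j) (τ j) (τ j) (⇑R ∘ z) c z₀ c₀ e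

/-- A single-tolerance cover is an indexed cover (index `Unit`). [formal bookkeeping] -/
theorem familyCoverSigma_of_familyCover {𝓘 : ChartFam} {ρ ε η₂ τ : ℝ} (h : FamilyCover 𝓘 ρ ε η₂ τ) :
    FamilyCoverSigma (fun _ : Unit => 𝓘) (fun _ => τ) ρ ε η₂ := fun M z c hz hcl hm hn hg => by
  obtain ⟨R, M₀, z₀, c₀, e, hch⟩ := h M z c hz hcl hm hn hg
  exact ⟨(), R, M₀, z₀, c₀, e, hch⟩

/-- ★★ (X2) **THE JUNCTION FOR PER-CELL TOLERANCES**: tube floors cell class by cell class, each at its own tolerance, and an indexed cover ⟹ the edge-far floor.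
[folklore — the proof of `edgeFar_of_tubeFloor_of_cover` with one more `obtain`] -/
theorem edgeFar_of_tubeFloors_of_coverSigma {J : Type*} {𝓙 : J → ChartFam} {τ : J → ℝ} {ρ ε η₂ : ℝ} (hT : ∀ j, TubeFloor (𝓙 j) (τ j))
    (hC : FamilyCoverSigma 𝓙 τ ρ ε η₂) : EdgeFarFloor (63 / 10) (63 / 10) ρ ε η₂ 0 := by
  intro M z c hz hcl hm hn hg
  obtain ⟨j, R, M₀, z₀, c₀, e, hch⟩ := hC M z c hz hcl hm hn hg
  have h₁ := hT j M (⇑R ∘ z) c M₀ z₀ c₀ e ((admissible_comp_iff R z c).2 hz) ((cleanBall_comp_iff R z c).2 hcl)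
    ((monoPhaseBall_comp_iff R z c).2 hm) hch
  rwa [ballAvg_xRec_comp] at h₁

/-- ★★ (X2) … and at `η₂ = 1/8`: [CORE-FAR]-shaped conclusion, SAME literal as the record junction. [folklore] -/
theorem coreOff_of_tubeFloors_of_coverSigma_eighth {J : Type*} {𝓙 : J → ChartFam} {τ : J → ℝ} {ρ ε : ℝ} (hT : ∀ j, TubeFloor (𝓙 j) (τ j))
    (hC : FamilyCoverSigma 𝓙 τ ρ ε (1 / 8)) : CoreOffTubeFloor (63 / 10) (63 / 10) ρ ε 0 :=
  (coreOff_iff_edge_and_soft _ _ ρ ε (1 / 8) 0).2 ⟨edgeFar_of_tubeFloors_of_coverSigma hT hC, softFarFloor_eighth (by norm_num) _ _ _ _⟩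

/-- (X2) RECORD-SHAPED member: two cell classes of the record family (a host predicate `P` and its complement) at tolerances `1/80` and `1/100`. [formal bookkeeping] -/
theorem coreOff_record_of_twoTolerances (P : ChartFam)
    (hT₁ : TubeFloor (fun M₀ z₀ c₀ => FamP M₀ z₀ c₀ ∧ P M₀ z₀ c₀) (1 / 80)) (hT₂ : TubeFloor (fun M₀ z₀ c₀ => FamP M₀ z₀ c₀ ∧ ¬P M₀ z₀ c₀) (1 / 100))
    (hC : FamilyCoverSigma (fun b : Bool => if b then (fun M₀ z₀ c₀ => FamP M₀ z₀ c₀ ∧ P M₀ z₀ c₀) else fun M₀ z₀ c₀ => FamP M₀ z₀ c₀ ∧ ¬P M₀ z₀ c₀)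
      (fun b => if b then 1 / 80 else 1 / 100) (24 / 5) (1 / 100) (1 / 8)) :
    CoreOffTubeFloor (63 / 10) (63 / 10) (24 / 5) (1 / 100) 0 :=
  coreOff_of_tubeFloors_of_coverSigma_eighth (fun b => by
      cases b
      · simpa using hT₂
      · simpa using hT₁) hC

end Summit.AtomisticToContinuum.Crystallization.Theorems.FrustratedLawDichotomyStrainedPatchChargePrice
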